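import Summits.Ventures.HodgeRepro2.T6N3Hyp

/-!
# T6N3Mult — multiplicity at most one on the inner form, from Rogawski's displayed theorems (row T4)

Cell pub-hodge-repro2, Tier 6 (README §10), seat t6-p3 (N3 owner, M2). Proof lane; count-neutral
(TARGET-T6 §7(j)). Record: TIER5 §N3.3 row T4 — «Conclusion used: m(σ) ≤ 1 for every irreducible
automorphic σ of U(V) — Π_a: Theorem 14.6.4 («equal to one … and is equal to zero otherwise»); Π_e:
Theorem 14.6.5 (m(π′) = |Π̂′|⁻¹ Σ_s ⟨s, π⟩, an average of characters of a finite abelian group ∈ {0, 1}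
— ONE line); Π_s: the displayed identity in the proof of Proposition 14.6.2 … — ONE line; coverage:
«their union is Π(G′)»». Here: the Π_a and Π_e cases from the displays `Rogawski1990_Thm14_6_4` /
`Rogawski1990_Thm14_6_5` (the Π_e line needs only that the average of signs `±1` is at most `1` and `m`
is a natural number), the coverage from `Rogawski1990_Sec14_6_Partition`, and the Π_s case as a BINDER
(`hs`) — the residual [G-N3-3] of the record (a sentence inside the proof of Proposition 14.6.2, not a
printed theorem), class AD at M2.

§8(d): uses an L-value-free non-vanishing device: NO.
-/

namespace Summit.Ventures.HodgeRepro2.T6.RogawskiPackets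

variable (R : RogawskiPackets)

/-- A sign `⟨s, π′⟩ ∈ {±1}`, cast to `ℚ`, is at most `1`. -/
lemma pair_cast_le_one (s : Option R.PiH) (π : R.Rep) : ((R.pair s π : ℤ) : ℚ) ≤ 1 := by
  rcases Int.units_eq_one_or (R.pair s π) with h | h <;> rw [h] <;> norm_num

/-- Theorem 14.6.5 ⟹ `m(π′) ≤ 1` for `π′` in a packet of `Π_e(G′)` («an average of characters of a
finite abelian group ∈ {0, 1}», row T4 — here: an average of signs is at most `1`). -/
lemma m_le_one_of_mem_Pe (h2 : Hyp.Rogawski1990_Thm14_6_5 R) {P' : R.Pkt} (hP : P' ∈ R.Pe)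
    {π : R.Rep} (hπ : R.mem π P') : R.m π ≤ 1 := by
  obtain ⟨ρ, -, -, hm⟩ := h2 P' hP
  have hq : (R.m π : ℚ) ≤ 1 := by
    rw [hm π hπ]
    by_cases hc : (R.PiHat P').card = 0
    · rw [hc]
      simp
    · have hcpos : (0 : ℚ) < (R.PiHat P').card := by
        exact_mod_cast Nat.pos_of_ne_zero hc
      rw [inv_mul_le_iff₀ hcpos, mul_one]
      calc (∑ s ∈ R.PiHat P', ((R.pair s π : ℤ) : ℚ))
          ≤ ∑ _s ∈ R.PiHat P', (1 : ℚ) := Finset.sum_le_sum fun s _ => R.pair_cast_le_one s π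
        _ = (R.PiHat P').card := by simp
  exact_mod_cast hq

/-- Theorem 14.6.4 ⟹ `m(π) ≤ 1` for `π` in a packet of `Π_a(G′)`. -/
lemma m_le_one_of_mem_Pa (h1 : Hyp.Rogawski1990_Thm14_6_4 R) {P' : R.Pkt} (hP : P' ∈ R.Pa)
    {π : R.Rep} (hπ : R.mem π P') : R.m π ≤ 1 := by
  obtain ⟨ξ, -, -, -, hm⟩ := h1 P' hP
  rw [hm π hπ]
  split_ifs <;> omega

/-- MULTIPLICITY AT MOST ONE on the inner form `G′` (TIER5 row T4): from the three Rogawski displays and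
the Π_s binder `hs` (the record's residual [G-N3-3]: «m(π) = 1 for π ∈ Π′ ∈ Π_s(G′)», the identity in
the proof of Proposition 14.6.2 — class AD at M2). -/
theorem multLeOne_of_displays (h0 : Hyp.Rogawski1990_Sec14_6_Partition R)
    (h1 : Hyp.Rogawski1990_Thm14_6_4 R) (h2 : Hyp.Rogawski1990_Thm14_6_5 R)
    (hs : ∀ P' ∈ R.Ps, ∀ π, R.mem π P' → R.m π ≤ 1) : R.MultLeOne := by
  intro P' hP π hπ
  rcases h0 P' hP with h | h | h
  · exact hs P' h π hπ
  · exact R.m_le_one_of_mem_Pe h2 h hπ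
  · exact R.m_le_one_of_mem_Pa h1 h hπ

end Summit.Ventures.HodgeRepro2.T6.RogawskiPackets
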